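import Summits.Ventures.HodgeRepro2.T5CyclotomicDyadic
import Summits.Ventures.HodgeRepro2.T5TameCongruence

/-!
# T5SexticSplittingTower — the splitting dictionary of the sextic field for EVERY rational prime

Seat p3 of the blind cell `pub-hodge-repro2` (Tier-5 support column for sub-step N2 of
`route/TIER5.md`).  Companion of `T5SexticDecomposition` behind row N2.2.5 of
`route/T5-N2-route-3.md` («a place of `F⁺` above `p` is non-split in `E` iff … iff `p` does NOT
split in the imaginary quadratic subfield `K`»).  `T5SexticDecomposition` proves the dictionary for
`p` unramified in `E` through the inertia degrees; here the same dictionary is proved for EVERY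
rational prime `p` (ramified ones included) through the multiplicativity of the number of primes in
a tower of Galois number fields (Mathlib's `Ideal.ncard_primesOver_mul_ncard_primesOver`):

* `g_F(p) · g_w(E/F) = g_E(p) = g_K(p) · g_𝔮(E/K)` for `w = P ∩ 𝓞 F`, `𝔮 = P ∩ 𝓞 K`;
* `g_w ∣ 2`, `g_𝔮 ∣ 3`, `g_F ∣ 3`, `g_K ∣ 2` (Galois identities `g · e · f = degree`);
* hence `g_w = 2 ⟺ g_K = 2` and `g_w = 1 ⟺ g_K = 1`: the place `w` of the cubic subfield has
  exactly one prime of `E` above it if and only if `p` has exactly one prime of `K` above it.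

Setting: number fields `F ⊆ E`, `K ⊆ E`, with `E`, `F`, `K` Galois over `ℚ`, `[E : F] = 2`,
`[E : K] = 3`, `[F : ℚ] = 3`, `[K : ℚ] = 2` (the sextic CM field with its cubic totally real and its
imaginary quadratic subfield).  The earlier witnesses `T5CyclotomicDyadic` (the fundamental identity
over `𝓞 F`) and `T5TameCongruence` (the fundamental identity over `ℤ`) are imported, not restated.

Declaration of README §8(d): this file uses an L-value-free non-vanishing device: NO.
-/

namespace Summit.Ventures.HodgeRepro2.T5SexticSplittingTower

open NumberField Ideal

section tower

variable {F E : Type*} [Field F] [NumberField F] [Field E] [NumberField E] [Algebra F E]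
  [IsGalois ℚ F] [IsGalois ℚ E]

/-- **Multiplicativity of the number of primes in a tower** `ℚ ⊆ F ⊆ E` of Galois number fields:
the number of primes of `𝓞 E` above a prime `p` of `ℤ` is the number of primes `w` of `𝓞 F` above
`p` times the (common) number of primes of `𝓞 E` above such a `w`. -/
theorem ncard_primesOver_mul_ncard_primesOver_int (p : Ideal ℤ) (w : Ideal (𝓞 F)) [w.IsPrime]
    [w.LiesOver p] :
    (p.primesOver (𝓞 F)).ncard * (w.primesOver (𝓞 E)).ncard = (p.primesOver (𝓞 E)).ncard := by
  haveI := T5TameCongruence.isGaloisGroup_gal (F := F)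
  haveI := T5TameCongruence.isGaloisGroup_gal (F := E)
  exact ncard_primesOver_mul_ncard_primesOver w Gal(F/ℚ) (𝓞 E) Gal(E/ℚ)

end tower

section relative

variable {F E : Type*} [Field F] [NumberField F] [Field E] [NumberField E] [Algebra F E]
  [IsGalois F E]

/-- In a Galois extension `E/F` of number fields, the number of primes of `𝓞 E` above a prime
`𝔭` of `𝓞 F` (witnessed by one such prime `P`) divides `[E : F]`. -/
theorem ncard_primesOver_dvd_finrank (𝔭 : Ideal (𝓞 F)) [𝔭.IsPrime] (P : Ideal (𝓞 E))
    [P.IsPrime] [P.LiesOver 𝔭] : (𝔭.primesOver (𝓞 E)).ncard ∣ Module.finrank F E :=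
  Dvd.intro _ (T5CyclotomicDyadic.ncard_primesOver_mul 𝔭 P)

/-- The number of primes above `𝔭` is non-zero (there is one, `P`). -/
theorem ncard_primesOver_ne_zero (𝔭 : Ideal (𝓞 F)) [𝔭.IsPrime] (P : Ideal (𝓞 E))
    [P.IsPrime] [P.LiesOver 𝔭] : (𝔭.primesOver (𝓞 E)).ncard ≠ 0 := by
  intro h
  have := T5CyclotomicDyadic.ncard_primesOver_mul 𝔭 P
  rw [h, zero_mul] at this
  exact (Module.finrank_pos (R := F) (M := E)).ne' this.symm

end relative

section base

variable {F : Type*} [Field F] [NumberField F] [IsGalois ℚ F]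

/-- In a Galois number field, the number of primes above a rational prime `p` (witnessed by one
such prime `P`) divides the degree. -/
theorem ncard_primesOver_dvd_finrank_int {p : ℕ} (hp : p.Prime) (P : Ideal (𝓞 F)) [P.IsPrime]
    [P.LiesOver (span {(p : ℤ)})] : ((span {(p : ℤ)}).primesOver (𝓞 F)).ncard ∣ Module.finrank ℚ F :=
  Dvd.intro _ (T5TameCongruence.ncard_primesOver_mul_ramificationIdx_mul_inertiaDeg hp P)

/-- The number of primes above `p` is non-zero (there is one, `P`). -/
theorem ncard_primesOver_ne_zero_int {p : ℕ} (hp : p.Prime) (P : Ideal (𝓞 F)) [P.IsPrime]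
    [P.LiesOver (span {(p : ℤ)})] : ((span {(p : ℤ)}).primesOver (𝓞 F)).ncard ≠ 0 := by
  intro h
  have := T5TameCongruence.ncard_primesOver_mul_ramificationIdx_mul_inertiaDeg hp P
  rw [h, zero_mul] at this
  exact (Module.finrank_pos (R := ℚ) (M := F)).ne' this.symm

end base

section sextic

variable {F K E : Type*} [Field F] [NumberField F] [Field K] [NumberField K] [Field E]
  [NumberField E] [Algebra F E] [Algebra K E] [IsGalois F E] [IsGalois K E]
  [IsGalois ℚ F] [IsGalois ℚ K] [IsGalois ℚ E]
  (hFE : Module.finrank F E = 2) (hKE : Module.finrank K E = 3)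
  (hF : Module.finrank ℚ F = 3) (hK : Module.finrank ℚ K = 2)
  {p : ℕ} (hp : p.Prime) (P : Ideal (𝓞 E)) [P.IsPrime] [P.LiesOver (span {(p : ℤ)})]

include hFE hKE hF hK hp in
/-- **The splitting dictionary of the sextic field, every `p`** (row N2.2.5): the place
`w = P ∩ 𝓞 F` of the cubic subfield SPLITS in `E` (two primes of `𝓞 E` above it) if and only if
`p` SPLITS in the quadratic subfield `K` (two primes of `𝓞 K` above it). -/
theorem ncard_primesOver_eq_two_iff :
    ((P.under (𝓞 F)).primesOver (𝓞 E)).ncard = 2 ↔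
      ((span {(p : ℤ)}).primesOver (𝓞 K)).ncard = 2 := by
  -- the two tower identities
  have h1 := ncard_primesOver_mul_ncard_primesOver_int (E := E) (span {(p : ℤ)}) (P.under (𝓞 F))
  have h2 := ncard_primesOver_mul_ncard_primesOver_int (E := E) (span {(p : ℤ)}) (P.under (𝓞 K))
  -- the four divisibilities
  have hw : ((P.under (𝓞 F)).primesOver (𝓞 E)).ncard ∣ 2 := by
    rw [← hFE]; exact ncard_primesOver_dvd_finrank (P.under (𝓞 F)) P
  have hq : ((P.under (𝓞 K)).primesOver (𝓞 E)).ncard ∣ 3 := by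
    rw [← hKE]; exact ncard_primesOver_dvd_finrank (P.under (𝓞 K)) P
  have hgF : ((span {(p : ℤ)}).primesOver (𝓞 F)).ncard ∣ 3 := by
    rw [← hF]; exact ncard_primesOver_dvd_finrank_int hp (P.under (𝓞 F))
  have hgK : ((span {(p : ℤ)}).primesOver (𝓞 K)).ncard ∣ 2 := by
    rw [← hK]; exact ncard_primesOver_dvd_finrank_int hp (P.under (𝓞 K))
  have hwpos : ((P.under (𝓞 F)).primesOver (𝓞 E)).ncard ≠ 0 :=
    ncard_primesOver_ne_zero (P.under (𝓞 F)) P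
  have hKpos : ((span {(p : ℤ)}).primesOver (𝓞 K)).ncard ≠ 0 :=
    ncard_primesOver_ne_zero_int hp (P.under (𝓞 K))
  have hoddq : ¬ 2 ∣ ((P.under (𝓞 K)).primesOver (𝓞 E)).ncard := fun h =>
    absurd (h.trans hq) (by norm_num)
  have hoddF : ¬ 2 ∣ ((span {(p : ℤ)}).primesOver (𝓞 F)).ncard := fun h =>
    absurd (h.trans hgF) (by norm_num)
  constructor
  · intro h
    have h2dvd : 2 ∣ ((span {(p : ℤ)}).primesOver (𝓞 K)).ncard *
        ((P.under (𝓞 K)).primesOver (𝓞 E)).ncard := by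
      rw [h2, ← h1, h]; exact Dvd.intro_left _ rfl
    have := ((Nat.Prime.dvd_mul Nat.prime_two).mp h2dvd).resolve_right hoddq
    exact Nat.le_antisymm (Nat.le_of_dvd (by norm_num) hgK)
      (Nat.le_of_dvd (Nat.pos_of_ne_zero hKpos) this)
  · intro h
    have h2dvd : 2 ∣ ((span {(p : ℤ)}).primesOver (𝓞 F)).ncard *
        ((P.under (𝓞 F)).primesOver (𝓞 E)).ncard := by
      rw [h1, ← h2, h]; exact Dvd.intro _ rfl
    have := ((Nat.Prime.dvd_mul Nat.prime_two).mp h2dvd).resolve_left hoddF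
    exact Nat.le_antisymm (Nat.le_of_dvd (by norm_num) hw)
      (Nat.le_of_dvd (Nat.pos_of_ne_zero hwpos) this)

include hFE hKE hF hK hp in
/-- **The splitting dictionary of the sextic field, every `p`** (row N2.2.5, «non-split» form):
the place `w = P ∩ 𝓞 F` of the cubic subfield is NON-SPLIT in `E` (exactly one prime of `𝓞 E`
above it) if and only if `p` does NOT split in the quadratic subfield `K` (exactly one prime of
`𝓞 K` above it) — ramified primes included. -/
theorem ncard_primesOver_eq_one_iff :
    ((P.under (𝓞 F)).primesOver (𝓞 E)).ncard = 1 ↔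
      ((span {(p : ℤ)}).primesOver (𝓞 K)).ncard = 1 := by
  have hw : ((P.under (𝓞 F)).primesOver (𝓞 E)).ncard ∣ 2 := by
    rw [← hFE]; exact ncard_primesOver_dvd_finrank (P.under (𝓞 F)) P
  have hgK : ((span {(p : ℤ)}).primesOver (𝓞 K)).ncard ∣ 2 := by
    rw [← hK]; exact ncard_primesOver_dvd_finrank_int hp (P.under (𝓞 K))
  have key := ncard_primesOver_eq_two_iff hFE hKE hF hK hp P
  rcases Nat.prime_two.eq_one_or_self_of_dvd _ hw with h | h <;>
    rcases Nat.prime_two.eq_one_or_self_of_dvd _ hgK with h' | h'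
  · simp [h, h']
  · exact absurd (key.mpr h') (by omega)
  · exact absurd (key.mp h) (by omega)
  · simp [h, h']

end sextic

end Summit.Ventures.HodgeRepro2.T5SexticSplittingTower
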